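import Summits.RiemannHypothesis.RiemannHypothesis.Theorems.Splittings.SplitXWucK1RM
import HarnessLib

/-!
# Splittings — x-wuc GEN-11 `SplitXWucK1R` (K1′(ℝ) AT THE STAKE) — mechanical carve part 14/14
Continuation of `Summits.RiemannHypothesis.RiemannHypothesis.Theorems.Splittings.SplitXWucK1RM`: byte-identical declaration units of the referee-passed extract `SplitXWucK1R.lean`
sha16 70c8eb2af2868881 (x-wuc g11; ref g10 PASS 2026-08-27T22:59:46Z; RULING #330); open namespaces/sections re-opened with their context.
HONEST LABEL: splitting search over kernel-typed RH-equivalences; K-CERT′ (complex `f`) stays OPEN; nothing here bears on the truth of RH.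
-/
set_option linter.dupNamespace false
noncomputable section
open scoped Classical ComplexConjugate
open Set Filter Topology Complex MeasureTheory
open Real Set Filter Topology
open Real Set MeasureTheory Complex Filter Topology
open scoped Real
namespace Summit.RiemannHypothesis.RiemannHypothesis.Theorems.Splittings.XWucG8
/-- **K1′(ℝ) AT THE STAKE, UNCONDITIONALLY:** `KCertLROn RealVal 400 (3/2) (21/500)` — every `f` real on `[−1,1]`, every density
`D ≥ 1`, every `ε > 0`, `κ₀ ∈ (0, ½)`.  (The node of record K-CERT′ = `KCertLR 400 (3/2) θ` quantifies over COMPLEX `f`; this is its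
real-valued class.  Nothing here bears on RH.) -/
theorem kCertLROn_realVal_stake : KCertLROn RealVal 400 (3 / 2) (21 / 500) := by
  intro ε hε κ₀ hκ₀ hκ₀' D hD f hf hfc
  by_cases hsmall : 2 * Real.pi * (21 / 500) * D ≤ 1
  · exact certBodyR_of_small_density hε.le hκ₀ (by linarith) (by norm_num) hsmall f hfc
  · exact DSLine.certBodyR_congr_Icc (fun u hu => (DSLine.clampF_eq f hu).symm)
      (DSLine.certBodyR_of_local hε hκ₀ hκ₀' hD le_rfl (le_of_lt (not_le.mp hsmall)) (DSLine.continuous_clampF hfc)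
        (DSLine.clampF_im hf))

/-- … hence at every `0 ≤ θ ≤ 21/500`. -/
theorem kCertLROn_realVal_of_le {θ : ℝ} (hθ : θ ≤ 21 / 500) : KCertLROn RealVal 400 (3 / 2) θ :=
  kCertLROn_anti hθ kCertLROn_realVal_stake

/-- … and the far-peak residual of §G11f is discharged at the stake. -/
theorem kCertFarResidual_stake : DSLine.KCertFarResidual (21 / 500) :=
  (DSLine.kCertLROn_realVal_iff_residual (by norm_num) (by norm_num)).mp kCertLROn_realVal_stake

end Summit.RiemannHypothesis.RiemannHypothesis.Theorems.Splittings.XWucG8
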